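import Mathlib.Analysis.Convex.Segment
import Mathlib.Topology.MetricSpace.HausdorffDistance
import Mathlib.Topology.MetricSpace.Bounded
import Mathlib.Combinatorics.SimpleGraph.Connectivity.Connected
import Mathlib.Data.Set.Card
import Mathlib.Algebra.Order.Round
import Literature.Probability.LatticeModels.LatticeGraph
import HarnessLib

-- provenance: harness21/H21/H21/Prelude/StatMech/DomainDiscretisation.lean @ 7fbbdec (interim HEAD d8f2665); M5 mechanical rewrite
/-!
# Discretisation of planar domains by `δℤ²` and discrete boundary arcs

Trunk: StatMech (prelude item P13 `DomainDiscretisation`, notion `domain_discretisation_mesh`).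

Given a planar domain `Ω ⊆ ℂ` and a mesh size `δ > 0` we set up the standard bookkeeping of the
discrete domain `Ω_δ ⊆ δℤ²` used in the scaling-limit statements of critical percolation and the
critical Ising model (Smirnov 2001; Chelkak–Smirnov, *Universality in the 2D Ising model and
conformal invariance of fermionic observables*, Invent. Math. 2012, §1.2; Chelkak–Hongler–Izyurov,
*Conformal invariance of spin correlations in the planar Ising model*, Ann. Math. 2015, §1.2 (CHI)):

* `meshPoint δ x = δ • x ∈ ℂ` for a site `x : Site 2`, and `nearestSite δ z = [z/δ]`
  (coordinatewise rounding), also available as `siteApprox`;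
* `meshVertices Ω δ`, the sites whose mesh point lies in `Ω`;
* `meshGraph Ω δ`, nearest-neighbour edges of `ℤ²` whose rescaled closed segment lies in `Ω̄`
  (CHI convention: closed edges inside the closure; vertices are required to lie in `Ω` itself
  through `meshVertices`);
* `meshDomain Ω δ`, the vertex set of `Ω_δ`: the largest connected component of the graph induced
  by `meshGraph Ω δ` on `meshVertices Ω δ` (Smirnov's wording; ties ↦ union of all largest
  components, a documented junk convention), and the pointed variant `meshComponent Ω δ z₀`
  (the component containing the site nearest to `z₀`, CHI convention);
* `discreteDomainGraph Ω δ`, the graph `Ω_δ` itself, its vertex boundary `meshBoundary Ω δ`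
  (vertices of `Ω_δ` with a `ℤ²`-neighbour not joined to them in `Ω_δ`; contains the inner vertex
  boundary of `Ω_δ`, the `Set` analogue of `innerBoundary` of `LatticeGraph.lean`), and the
  discretisation `discreteArc Ω δ A` of a boundary arc `A ⊆ ∂Ω` (boundary vertices at least as
  close to `A` as to the rest of `∂Ω`).

Families indexed by the mesh size use the filter `𝓝[>] (0 : ℝ)` for `δ → 0⁺`.

Mathlib anchors used rather than re-defined: `round` (`Mathlib.Algebra.Order.Round`), `segment ℝ`,
`closure`, `frontier`, `Metric.infDist`, `SimpleGraph.fromRel`, `SimpleGraph.induce`,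
`SimpleGraph.ConnectedComponent.supp`, `SimpleGraph.Reachable`, `Set.ncard`,
`Bornology.IsBounded`. Mathlib has no notion of lattice discretisation of a domain.
-/

namespace Literature.Probability.LatticeModels

open scoped Topology

noncomputable section

/-! ### Mesh points and rounding -/

/-- The point of the rescaled lattice `δℤ² ⊆ ℂ` corresponding to the site `x`, namely
`δ · (x₀ + i x₁)`. (Chelkak–Smirnov 2012, §1.2.) [cite: ChelkakSmirnov2012, §1.2] -/
def meshPoint (δ : ℝ) (x : Site 2) : ℂ := (δ : ℂ) * Site.toComplex x

/-- `meshPoint` in coordinates. (Chelkak–Smirnov 2012, §1.2.) [cite: ChelkakSmirnov2012, §1.2] -/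
@[simp] theorem meshPoint_re (δ : ℝ) (x : Site 2) : (meshPoint δ x).re = δ * x 0 := by
  simp [meshPoint]

/-- `meshPoint` in coordinates. (Chelkak–Smirnov 2012, §1.2.) [cite: ChelkakSmirnov2012, §1.2] -/
@[simp] theorem meshPoint_im (δ : ℝ) (x : Site 2) : (meshPoint δ x).im = δ * x 1 := by
  simp [meshPoint]

/-- The lattice site of `ℤ²` nearest to `z/δ`, obtained by rounding both coordinates
(`[z/δ]` in the notation of Chelkak–Hongler–Izyurov 2015, §1.2). Ties are broken by Mathlib's
`round` (round half up). For `δ = 0` this is the junk value `0` (`z.re / 0 = 0`). [cite: ChelkakHonglerIzyurov2015, §1.2] -/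
def nearestSite (δ : ℝ) (z : ℂ) : Site 2 := ![round (z.re / δ), round (z.im / δ)]

/-- The site approximation `a ↦ [a/δ]` of a marked point `a ∈ Ω` used for discrete spin
correlations; this is literally `nearestSite` (Mathlib-style `alias`, kept only because the
StatMech outline P13 plans this name for the spin-correlation statements).
(Chelkak–Hongler–Izyurov 2015, §1.2.) -/
alias siteApprox := nearestSite

/-- Rounding recovers a lattice site from its mesh point (for `δ ≠ 0`).
(Chelkak–Hongler–Izyurov 2015, §1.2.) [cite: ChelkakHonglerIzyurov2015, §1.2] -/
theorem nearestSite_meshPoint {δ : ℝ} (hδ : δ ≠ 0) (x : Site 2) :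
    nearestSite δ (meshPoint δ x) = x := by
  ext i
  fin_cases i <;> simp [nearestSite, mul_div_cancel_left₀ _ hδ]

/-- The mesh point of the nearest site is within `δ` of `z` (in fact within `δ/√2`).
(Chelkak–Hongler–Izyurov 2015, §1.2.) [cite: ChelkakHonglerIzyurov2015, §1.2] -/
theorem dist_meshPoint_nearestSite_le {δ : ℝ} (hδ : 0 < δ) (z : ℂ) :
    dist (meshPoint δ (nearestSite δ z)) z ≤ δ := by
  have key : ∀ a : ℝ, |δ * (round (a / δ) : ℤ) - a| ≤ δ / 2 := fun a => by
    have h := abs_sub_round (a / δ)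
    have : δ * (round (a / δ) : ℤ) - a = -(δ * (a / δ - round (a / δ))) := by
      field_simp; ring
    rw [this, abs_neg, abs_mul, abs_of_pos hδ]
    nlinarith
  rw [Complex.dist_eq]
  refine (Complex.norm_le_abs_re_add_abs_im _).trans ?_
  have h0 := key z.re
  have h1 := key z.im
  simp only [Complex.sub_re, Complex.sub_im, meshPoint_re, meshPoint_im, nearestSite,
    Matrix.cons_val_zero, Matrix.cons_val_one] at h0 h1 ⊢
  linarith

/-! ### Vertices and edges of the discretised domain -/

/-- The sites of `ℤ²` whose rescaled mesh point lies in the domain `Ω`.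
(Chelkak–Smirnov 2012, §1.2; Chelkak–Hongler–Izyurov 2015, §1.2.) [cite: ChelkakSmirnov2012, §1.2] -/
def meshVertices (Ω : Set ℂ) (δ : ℝ) : Set (Site 2) := {x | meshPoint δ x ∈ Ω}

/-- Membership in `meshVertices`, unfolded. (Chelkak–Smirnov 2012, §1.2.) [cite: ChelkakSmirnov2012, §1.2] -/
@[simp] theorem mem_meshVertices_iff {Ω : Set ℂ} {δ : ℝ} {x : Site 2} :
    x ∈ meshVertices Ω δ ↔ meshPoint δ x ∈ Ω := Iff.rfl

/-- The mesh graph of `Ω` at scale `δ`: two nearest neighbours `x ∼ y` of `ℤ²` are joined iff the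
closed segment `[δx, δy]` lies in the closure `Ω̄` (Chelkak–Hongler–Izyurov 2015, §1.2: "edges are
closed segments in `Ω̄`"). This is a graph on all of `Site 2`; the discrete domain restricts it to
`meshVertices Ω δ`. Junk value at `δ = 0`: all mesh points collapse to `0`, so `meshGraph Ω 0` is
all of `zdGraph 2` if `0 ∈ Ω̄` and `⊥` otherwise; only `δ > 0` is meaningful. [cite: ChelkakHonglerIzyurov2015, §1.2: "edges are closed segments in  Ω̄] -/
def meshGraph (Ω : Set ℂ) (δ : ℝ) : SimpleGraph (Site 2) :=
  SimpleGraph.fromRel fun x y =>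
    (zdGraph 2).Adj x y ∧ segment ℝ (meshPoint δ x) (meshPoint δ y) ⊆ closure Ω

/-- Adjacency in the mesh graph, unfolded. (Chelkak–Hongler–Izyurov 2015, §1.2.) [cite: ChelkakHonglerIzyurov2015, §1.2] -/
theorem meshGraph_adj_iff {Ω : Set ℂ} {δ : ℝ} {x y : Site 2} :
    (meshGraph Ω δ).Adj x y ↔
      (zdGraph 2).Adj x y ∧ segment ℝ (meshPoint δ x) (meshPoint δ y) ⊆ closure Ω := by
  simp only [meshGraph, SimpleGraph.fromRel_adj, ne_eq]
  constructor
  · rintro ⟨-, h | h⟩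
    · exact h
    · exact ⟨h.1.symm, segment_symm ℝ (meshPoint δ y) (meshPoint δ x) ▸ h.2⟩
  · intro h
    exact ⟨h.1.ne, Or.inl h⟩

/-- The mesh graph is a subgraph of the nearest-neighbour graph `ℤ²`.
(Chelkak–Hongler–Izyurov 2015, §1.2.) [cite: ChelkakHonglerIzyurov2015, §1.2] -/
theorem meshGraph_le_zdGraph (Ω : Set ℂ) (δ : ℝ) : meshGraph Ω δ ≤ zdGraph 2 :=
  fun _ _ h => (meshGraph_adj_iff.1 h).1

/-- For a bounded domain and a positive mesh size there are finitely many mesh vertices.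
(Chelkak–Smirnov 2012, §1.2.) [cite: ChelkakSmirnov2012, §1.2] -/
theorem meshVertices_finite {Ω : Set ℂ} {δ : ℝ} (hΩ : Bornology.IsBounded Ω) (hδ : 0 < δ) :
    (meshVertices Ω δ).Finite := by
  obtain ⟨r, hr⟩ := (Metric.isBounded_iff_subset_closedBall (0 : ℂ)).1 hΩ
  refine (Set.Finite.pi (t := fun _ : Fin 2 => Set.Icc (⌊-(r / δ)⌋) (⌈r / δ⌉))
    fun _ => Set.finite_Icc _ _).subset ?_
  intro x hx
  have hz := hr hx
  rw [Metric.mem_closedBall, dist_zero_right] at hz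
  have hre := (Complex.abs_re_le_norm _).trans hz
  have him := (Complex.abs_im_le_norm _).trans hz
  rw [meshPoint_re, abs_mul, abs_of_pos hδ] at hre
  rw [meshPoint_im, abs_mul, abs_of_pos hδ] at him
  have key : ∀ a : ℤ, δ * |(a : ℝ)| ≤ r → a ∈ Set.Icc (⌊-(r / δ)⌋) (⌈r / δ⌉) := fun a ha => by
    have ha' : |(a : ℝ)| ≤ r / δ := by rwa [le_div_iff₀ hδ, mul_comm]
    obtain ⟨h1, h2⟩ := abs_le.1 ha'
    exact ⟨Int.cast_le.1 ((Int.floor_le _).trans h1), Int.cast_le.1 (h2.trans (Int.le_ceil _))⟩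
  simp only [Set.mem_pi, Set.mem_univ, forall_true_left, Fin.forall_fin_two]
  exact ⟨key _ hre, key _ him⟩

/-! ### The discrete domain `Ω_δ` -/

/-- The mesh graph induced on the mesh vertices, `(meshGraph Ω δ).induce (meshVertices Ω δ)`,
a graph on the subtype `↥(meshVertices Ω δ)`; its connected components are the candidate
discrete domains. (Smirnov 2001; Chelkak–Smirnov 2012, §1.2.) [cite: Smirnov2001] -/
abbrev meshVertexGraph (Ω : Set ℂ) (δ : ℝ) : SimpleGraph (meshVertices Ω δ) :=
  (meshGraph Ω δ).induce (meshVertices Ω δ)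

/-- The vertex set of the discrete domain `Ω_δ`: the union of the supports (as subsets of
`Site 2`) of those connected components of `meshVertexGraph Ω δ` whose cardinality `Set.ncard`
is maximal — "the largest connected component of `Ω ∩ δℤ²`" (Smirnov 2001, §2;
Chelkak–Smirnov 2012, §1.2). Junk conventions: if several components have maximal size, their
union is taken; infinite components have `ncard = 0`, so this is only meaningful when
`meshVertices Ω δ` is finite (`meshVertices_finite`). [cite: Smirnov2001, §2] -/
def meshDomain (Ω : Set ℂ) (δ : ℝ) : Set (Site 2) :=
  ⋃ (C : (meshVertexGraph Ω δ).ConnectedComponent)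
    (_ : ∀ C' : (meshVertexGraph Ω δ).ConnectedComponent, C'.supp.ncard ≤ C.supp.ncard),
    Subtype.val '' C.supp

/-- The pointed discrete domain: the mesh vertices connected inside `meshVertexGraph Ω δ` to the
site `nearestSite δ z₀` nearest to a marked point `z₀` (Chelkak–Hongler–Izyurov 2015, §1.2:
"the connected component of `Ω ∩ δℤ²` containing a given point"). Empty (junk) if the nearest
site to `z₀` is not itself a mesh vertex. [cite: ChelkakHonglerIzyurov2015, §1.2: "the connected component of  Ω ∩ δ] -/
def meshComponent (Ω : Set ℂ) (δ : ℝ) (z₀ : ℂ) : Set (Site 2) :=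
  {x | ∃ (h₀ : nearestSite δ z₀ ∈ meshVertices Ω δ) (hx : x ∈ meshVertices Ω δ),
    (meshVertexGraph Ω δ).Reachable ⟨nearestSite δ z₀, h₀⟩ ⟨x, hx⟩}

/-- The discrete domain is made of mesh vertices. (Chelkak–Smirnov 2012, §1.2.) [cite: ChelkakSmirnov2012, §1.2] -/
theorem meshDomain_subset_meshVertices (Ω : Set ℂ) (δ : ℝ) :
    meshDomain Ω δ ⊆ meshVertices Ω δ := by
  intro x hx
  simp only [meshDomain, Set.mem_iUnion, Set.mem_image] at hx
  obtain ⟨_, _, y, _, rfl⟩ := hx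
  exact y.2

/-- The pointed discrete domain is made of mesh vertices. (Chelkak–Hongler–Izyurov 2015, §1.2.) [cite: ChelkakHonglerIzyurov2015, §1.2] -/
theorem meshComponent_subset_meshVertices (Ω : Set ℂ) (δ : ℝ) (z₀ : ℂ) :
    meshComponent Ω δ z₀ ⊆ meshVertices Ω δ :=
  fun _ ⟨_, hx, _⟩ => hx

/-- The graph `Ω_δ`: the mesh graph restricted to the discrete domain `meshDomain Ω δ` (as a graph
on all of `Site 2`, with the sites outside `Ω_δ` isolated). (Chelkak–Smirnov 2012, §1.2.) [cite: ChelkakSmirnov2012, §1.2] -/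
def discreteDomainGraph (Ω : Set ℂ) (δ : ℝ) : SimpleGraph (Site 2) :=
  SimpleGraph.fromRel fun x y => (meshGraph Ω δ).Adj x y ∧ x ∈ meshDomain Ω δ ∧ y ∈ meshDomain Ω δ

/-- Adjacency in `Ω_δ`, unfolded. (Chelkak–Smirnov 2012, §1.2.) [cite: ChelkakSmirnov2012, §1.2] -/
theorem discreteDomainGraph_adj_iff {Ω : Set ℂ} {δ : ℝ} {x y : Site 2} :
    (discreteDomainGraph Ω δ).Adj x y ↔
      (meshGraph Ω δ).Adj x y ∧ x ∈ meshDomain Ω δ ∧ y ∈ meshDomain Ω δ := by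
  simp only [discreteDomainGraph, SimpleGraph.fromRel_adj, ne_eq]
  constructor
  · rintro ⟨-, h | h⟩
    · exact h
    · exact ⟨h.1.symm, h.2.2, h.2.1⟩
  · intro h
    exact ⟨h.1.ne, Or.inl h⟩

/-- `Ω_δ` is a subgraph of the mesh graph. (Chelkak–Smirnov 2012, §1.2.) [cite: ChelkakSmirnov2012, §1.2] -/
theorem discreteDomainGraph_le_meshGraph (Ω : Set ℂ) (δ : ℝ) :
    discreteDomainGraph Ω δ ≤ meshGraph Ω δ :=
  fun _ _ h => (discreteDomainGraph_adj_iff.1 h).1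

/-! ### Discrete boundary and boundary arcs -/

/-- The vertex boundary `∂Ω_δ` of the discrete domain: vertices `x ∈ Ω_δ` having a nearest
neighbour `y` in `ℤ²` to which they are *not* joined by an edge of `Ω_δ = discreteDomainGraph Ω δ`,
i.e. either `y ∉ Ω_δ` (the inner vertex boundary of `Ω_δ` in `ℤ²` — this is the `Set`-valued
analogue of `innerBoundary (zdGraph 2)` from `LatticeGraph.lean`, see
`mem_meshBoundary_of_adj_not_mem`), or `y ∈ Ω_δ` but the rescaled closed edge `[δx, δy]` leaves
`Ω̄` (e.g. across a slit). For the open unit square and `δ = 1/n` this is the set of mesh vertices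
with a coordinate in `{1, n-1}`. (Smirnov 2001, §2; Chelkak–Smirnov 2012, §1.2.) [cite: Smirnov2001, §2] -/
def meshBoundary (Ω : Set ℂ) (δ : ℝ) : Set (Site 2) :=
  {x ∈ meshDomain Ω δ | ∃ y, (zdGraph 2).Adj x y ∧ ¬ (discreteDomainGraph Ω δ).Adj x y}

/-- Membership in the discrete boundary, unfolded. (Chelkak–Smirnov 2012, §1.2.) [cite: ChelkakSmirnov2012, §1.2] -/
@[simp] theorem mem_meshBoundary_iff {Ω : Set ℂ} {δ : ℝ} {x : Site 2} :
    x ∈ meshBoundary Ω δ ↔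
      x ∈ meshDomain Ω δ ∧ ∃ y, (zdGraph 2).Adj x y ∧ ¬ (discreteDomainGraph Ω δ).Adj x y :=
  Iff.rfl

/-- Membership in the discrete boundary in terms of the mesh graph: a vertex of `Ω_δ` is a
boundary vertex iff some `ℤ²`-neighbour is outside `Ω_δ` or is not joined to it in the mesh
graph. (Chelkak–Smirnov 2012, §1.2.) [cite: ChelkakSmirnov2012, §1.2] -/
theorem mem_meshBoundary_iff' {Ω : Set ℂ} {δ : ℝ} {x : Site 2} :
    x ∈ meshBoundary Ω δ ↔ x ∈ meshDomain Ω δ ∧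
      ∃ y, (zdGraph 2).Adj x y ∧ (y ∉ meshDomain Ω δ ∨ ¬ (meshGraph Ω δ).Adj x y) := by
  rw [mem_meshBoundary_iff]
  refine and_congr_right fun hx => exists_congr fun y => and_congr_right fun _ => ?_
  rw [discreteDomainGraph_adj_iff]
  tauto

/-- The inner vertex boundary of `Ω_δ` in `ℤ²` (vertices of `Ω_δ` with a `ℤ²`-neighbour outside
`Ω_δ`, cf. `innerBoundary` in `LatticeGraph.lean`) is contained in the discrete boundary.
(Smirnov 2001, §2.) [cite: Smirnov2001, §2] -/
theorem mem_meshBoundary_of_adj_not_mem {Ω : Set ℂ} {δ : ℝ} {x y : Site 2}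
    (hx : x ∈ meshDomain Ω δ) (hxy : (zdGraph 2).Adj x y) (hy : y ∉ meshDomain Ω δ) :
    x ∈ meshBoundary Ω δ :=
  ⟨hx, y, hxy, fun h => hy (discreteDomainGraph_adj_iff.1 h).2.2⟩

/-- The discrete boundary lies in the discrete domain. (Chelkak–Smirnov 2012, §1.2.) [cite: ChelkakSmirnov2012, §1.2] -/
theorem meshBoundary_subset_meshDomain (Ω : Set ℂ) (δ : ℝ) :
    meshBoundary Ω δ ⊆ meshDomain Ω δ :=
  fun _ h => h.1

/-- The discretisation of a boundary arc `A ⊆ ∂Ω`: the discrete boundary vertices whose mesh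
point is at least as close to `A` as to the complementary part `∂Ω \ A` of the boundary
(Smirnov 2001, §2: "the discrete arc is the set of boundary vertices closest to the arc";
Chelkak–Smirnov 2012, §1.2). Conventions: the comparison is `≤`, so a boundary vertex
equidistant from `A` and `∂Ω \ A` belongs to both `discreteArc Ω δ A` and
`discreteArc Ω δ (frontier Ω \ A)` (the two discrete arcs may share their endpoints); if
`∂Ω \ A = ∅` then `Metric.infDist _ ∅ = 0`, so only vertices lying on `Ā` qualify (junk case). [cite: Smirnov2001, §2: "the discrete arc is the set of boun] -/
def discreteArc (Ω : Set ℂ) (δ : ℝ) (A : Set ℂ) : Set (Site 2) :=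
  {x ∈ meshBoundary Ω δ |
    Metric.infDist (meshPoint δ x) A ≤ Metric.infDist (meshPoint δ x) (frontier Ω \ A)}

/-- Membership in a discrete arc, unfolded. (Smirnov 2001, §2.) [cite: Smirnov2001, §2] -/
@[simp] theorem mem_discreteArc_iff {Ω : Set ℂ} {δ : ℝ} {A : Set ℂ} {x : Site 2} :
    x ∈ discreteArc Ω δ A ↔ x ∈ meshBoundary Ω δ ∧
      Metric.infDist (meshPoint δ x) A ≤ Metric.infDist (meshPoint δ x) (frontier Ω \ A) :=
  Iff.rfl

/-- A discrete arc lies in the discrete boundary. (Smirnov 2001, §2.) [cite: Smirnov2001, §2] -/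
theorem discreteArc_subset_meshBoundary (Ω : Set ℂ) (δ : ℝ) (A : Set ℂ) :
    discreteArc Ω δ A ⊆ meshBoundary Ω δ :=
  fun _ h => h.1

/-- For a bounded domain and positive mesh, the discrete domain is finite.
(Chelkak–Smirnov 2012, §1.2.) [cite: ChelkakSmirnov2012, §1.2] -/
theorem meshDomain_finite {Ω : Set ℂ} {δ : ℝ} (hΩ : Bornology.IsBounded Ω) (hδ : 0 < δ) :
    (meshDomain Ω δ).Finite :=
  (meshVertices_finite hΩ hδ).subset (meshDomain_subset_meshVertices Ω δ)

end

end Literature.Probability.LatticeModels
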